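import Literature.NumberTheory.EllipticCurves.Wuthrich2014.ReducibleDivisibilityCyclotomicPrime
import Literature.NumberTheory.EllipticCurves.SelmerRestrictionCorankRelative
import Literature.NumberTheory.EllipticCurves.PAdicBSD
import HarnessLib

/-!
# Wuthrich 2014, Thm. 16 for an odd prime `p` (good ordinary case, `E[p]` reducible), the SINGLE
# component `i = (p−1)/2`: `char_{Λ(Γ)} e_{(p−1)/2}X(E/ℚ(ζ_{p^∞})) ∋ u · L_p(E, ω^{(p−1)/2}, T)`, read on
# the `χ_{ℚ(√p*)}`-eigenspace of `Sel_{p^∞}(E/ℚ(μ_{p^∞}))` in the subgroup model over `Γ_ℚ`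

Source: C. Wuthrich, *On the integrality of modular symbols and Kato's Euler system for elliptic
curves*, Doc. Math. 19 (2014) 381–402 [Wuthrich2014], **Theorem 16** (p. 397), with §5 (p. 397:
the Selmer group over `ℚ(ζ_{p^n})`, `X(E)` = the dual of the limit; "If the reduction is good
ordinary, theorem 17.4 in [8] shows that `X(E)` is `Λ`-torsion"), §1 Thm. 3 ("We formulate it here
for the full cyclotomic `ℤ_p^×`-extension"), §3 (p. 390: "Any `Λ`-module `M` comes equipped with
an action by the group `Δ = Gal(ℚ(ζ_p)/ℚ)` and we split `M` up into the eigenspaces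
`M = ⊕_{i=0}^{p−2} M_i` where `Δ` acts on `M_i = M^{(−i)Δ}` by the `i`-th power of the Teichmüller
character"; `Λ = ℤ_p[Δ]⟦Γ⟧`), Lemma 17 and Cor. 18 (p. 398: `L_p(E) ∈ Λ`). ONE NAMED FACT
(`def … : Prop`, nothing asserted, D-0014): Theorem 16 for an odd prime `p` of good ordinary
reduction on the ONE eigen-component `i = (p−1)/2` — the component SIBLING of the all-branches
PRODUCT reading `charIdeal_dvd_padicLFunction_cyclotomicPrime` (same printed sentences; that file
multiplies the `p − 1` component statements together, this one keeps the single component the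
twist `E ⊗ (·/p)` needs); flag family `Wu14-Thm16-pgen-branch-split`, ONE component. Reducible twin
of `Kato2004.charIdeal_dvd_padicLFunctionBranch_component_of_surjective` (same module shape, same
conclusion).

## The reading — that of the product sibling, STOPPED ONE STEP EARLIER (no multiplication over `i`)

Theorem 16 (p. 397): "Let `E/ℚ` be an elliptic curve and let `p > 2` be a prime. Suppose that `E`
has semi-stable reduction at `p` and that `E[p]` is reducible as a `G_ℚ`-module. Then
`char_Λ X(E)` divides the ideal generated by `L_p(E)`." Here `Λ = ℤ_p⟦G⟧`,
`G = Gal(ℚ(ζ_{p^∞})/ℚ) ≅ ℤ_p^× = Δ × Γ`, `X(E)` the Pontryagin dual of `lim_n Sel(E/ℚ(ζ_{p^n}))`,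
`L_p(E) ∈ Λ` (Cor. 18) the Néron-normalised Mazur–Swinnerton-Dyer measure on `ℤ_p^×` (p. 381).
`Λ = ⊕_{i=0}^{p−2} Λ(Γ)e_i` (`#Δ = p − 1` prime to `p`), every `Λ`-module is `M = ⊕ e_iM` (p. 390),
the characteristic ideal of a finitely generated torsion `Λ`-module is `⊕_i char(e_iM)e_i`, and
"`char_Λ X(E)` divides `(L_p(E))`" says `e_iL_p(E) ∈ char_{Λ(Γ)}(e_iX)` for EVERY `i`. THIS FACT is
that statement for the single index `i = m := (p−1)/2`: `e_mL_p(E) = L_p(E, ω^m, T)` is the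
`ω^m`-branch of `μ_E` (Mazur–Tate–Teitelbaum 1986 §I.13), on the PLUS modular symbols if `m` is even
(`p ≡ 1 (mod 4)`; tree `padicLFunctionBranch f α m`) and on the MINUS symbols if `m` is odd
(`p ≡ 3 (mod 4)`; tree `padicLFunctionMinusBranch f α m`); in the tree's normalisation by the newform
period of that parity (`ϖ·Ω_E = Ω⁺_f`, resp. `ϖ·|Ω⁻(E)| = Ω⁻_f`) it is `u·ϖ·B_m`, `u ∈ ℤ_p^×`
(signs, `c_∞`, powers of `2`) — ONE factor of the product sibling's `u·ϖ^{m}ϖ'^{m}·∏_i B_i`.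

THE MODULE `e_mX`, in the tree's SUBGROUP MODEL over `Γ_ℚ` (the convention of the tree's Iwasawa
theory, `WeierstrassCurve.selmerGroupOver`, `selmerInfty`; Greenberg LNM 1716 §1–2): let `κ` be the
cyclotomic `ℤ_p`-extension of `ℚ` (`κ.IsCyclotomic`: `ker κ = Gal(ℚ̄/ℚ_∞)`), `F = ℚ(ζ_p)`
(`IsCyclotomicExtension {p} ℚ F`) and `K` the quadratic field with `θ² = p* = (−1)^{(p−1)/2}p` — the
unique quadratic subfield of `F` (Gauss: `p* = (∑_a (a/p)ζ_p^a)²`), so that inside `ℚ̄` the field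
cut out by `H := ker κ ⊓ Gal(ℚ̄/K) ⊓ Gal(ℚ̄/F)` (`galRange`) is `ℚ_∞·K·F = ℚ_∞·F = ℚ(μ_{p^∞})`. Then
`lim_n Sel(E/ℚ(ζ_{p^n})) = Sel_{p^∞}(E/ℚ(μ_{p^∞}))` ("defined as usual as the elements … that are
locally in the image of the points", p. 397) is `V.selmerGroupOver p H` (classes of `H¹(H, E[p^∞])`
with the local conditions at all places — the SAME identification the product sibling makes with
`selmerInfty` of the cyclotomic `ℤ_p`-extension of the number field `ℚ(ζ_p)`: both are
`Sel_{p^∞}(E/ℚ(μ_{p^∞}))`), and `G = Γ_ℚ/H` acts by the conjugation action `conjH1`. `Δ` is the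
image of `ker κ = Gal(ℚ̄/ℚ_∞)` (as `Gal(ℚ(μ_{p^∞})/ℚ_∞) ≅ Gal(F/ℚ) = Δ`), and
`ω^m = ω^{(p−1)/2}` is the unique quadratic character of `Δ ≅ (ℤ/p)^×`, i.e. `ω^m(g) = +1` iff
`g|_F` fixes `K`, iff `g ∈ Gal(ℚ̄/K)`: so `e_m Sel_{p^∞}(E/ℚ(μ_{p^∞})) = {t : g_* t = ω^m(g) t ∀ g}` is
the subgroup `S` of Selmer classes with `g_* t = t` for `g ∈ ker κ ∩ Gal(ℚ̄/K)` and `g_* t = −t`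
for `g ∈ ker κ ∖ Gal(ℚ̄/K)` (hypothesis `hS`, an `↔`), a direct summand (`p ∤ #Δ`), with Pontryagin
dual `e_mX(E)`. The `Λ(Γ)`-structure: `Γ = Gal(ℚ(μ_{p^∞})/F) ↔ 1 + pℤ_p`, `T = γ − 1` for the
topological generator `γ ↔ 1 + p` (`cyclotomicGenerator p`); below `γ ∈ Γ_ℚ` lies in
`Gal(ℚ̄/K) ⊓ Gal(ℚ̄/F)`, `κ γ` generates (`IsTopGenerator`), and `χ_p(γ)·ζ = 1 + p` with `ζ`
torsion (`IsCyclotomicVariable p γ`; as `γ` fixes `ζ_p`, `ζ = 1`), so `γ` acts on `S` by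
`conjH1 γ` (hypothesis `hSγ`) as the generator of `Γ`. A `Λ`-dual datum of `S` is spelled out field
by field exactly as the tree's `WeierstrassCurve.SelmerDualData` (Greenberg LNM 1716 §1 p. 60): an
abstract `Λ = ℤ_p⟦T⟧`-module `X` with a bijection `toDual : X ≅ Hom(S, ℚ/ℤ)`, `T` acting as
`γ_* − 1`, constants through `ℤ_p → ℤ/p^k` (the cell's sub-cell additive-p2 packages these fields as
`Summit.….Additive.ChiEigenSelmerInDualData`, gen 12, and proves in the kernel that every `Λ`-dual
datum of `Sel_{p^∞}(E ⊗ (·/p) / ℚ_∞)` gives one with the same module — the descent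
`ℚ(μ_{p^∞}) → ℚ_∞(√p*) → ℚ_∞` is NOT part of this fact).

Hypotheses transcribed: `E = V` globally minimal over `ℚ`, good ordinary at `p` (`IsOrdinaryAt V p`;
printed for semi-stable `p` — transcribed for good ordinary only, as the product sibling), `E[p]`
reducible (`¬ V.HasIrreducibleModPGaloisRep p`), `p ≠ 2`; `f` the newform of `E`,
`α = unitRoot V p`. Conclusion: `X` (= `e_mX(E)`) is `Λ`-torsion (§5 p. 397 via Kato 17.4 (1); a
direct summand of the torsion `X(E)`) and `u·ϖ·B_m = ι g` for some `g ∈ char_Λ X`, `u ∈ ℤ_p^×`,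
`B_m` the `ω^m`-branch of the parity of `m`.

What is NOT here: the other components; the multiplicative case of Thm. 16 (and its split
correction factor, which lives on `e₀` only); `p = 2`; any proof. No `_holds` is to be expected.
-- TODO(general form): Thm. 16 componentwise for every `i mod p − 1` and for semi-stable `p`
-- (multiplicative reduction, with the factor of Thm. 4 / Cor. 19 on the trivial component).

Consumer: the BSD rank-≤1 residual cell (`b2b-bsdres`), additive sub-cell: with additive-p1's kernel
transport [C] and additive-p2's kernel eigen-descent `ℚ(μ_{p^∞}) → ℚ_∞(√p*)`, this fact yields
`char_Λ X(E^{(p*)}/ℚ_∞) ∋ u·ϖ·L_p(E, ω^{(p−1)/2}, T)` for the ADDITIVE twist `E^{(p*)}` with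
`E[p]` REDUCIBLE (classes X3♯(G-ord) / X3♯(M) with a good ordinary twist), i.e. the typed input
`ChiBranchLeadingTerm[Odd]At` at every odd `p`.
-/

set_option autoImplicit false

noncomputable section

open scoped Classical MatrixGroups ModularForm

open CongruenceSubgroup WeierstrassCurve Literature.NumberTheory.EllipticCurves
  Literature.NumberTheory.EllipticCurves.ModularForms
  Literature.NumberTheory.GaloisRepresentations

namespace Literature.NumberTheory.EllipticCurves.Wuthrich2014

/-- **Wuthrich 2014, Theorem 16 for an odd prime `p`, good ordinary case, `E[p]` reducible,
component `i = (p−1)/2`, read on the `χ_{ℚ(√p*)}`-eigenspace of `Sel_{p^∞}(E/ℚ(μ_{p^∞}))`: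
`char_{Λ(Γ)} e_{(p−1)/2}X(E/ℚ(ζ_{p^∞})) ∋ u · L_p(E, ω^{(p−1)/2}, T)`.** As printed (Doc. Math. 19
(2014), Thm. 16, p. 397): "Let `E/ℚ` be an elliptic curve and let `p > 2` be a prime. Suppose that
`E` has semi-stable reduction at `p` and that `E[p]` is reducible as a `G_ℚ`-module. Then
`char_Λ X(E)` divides the ideal generated by `L_p(E)`." — with `Λ = ℤ_p⟦Gal(ℚ(ζ_{p^∞})/ℚ)⟧`
(§1 Thm. 3; §3 p. 390), `X(E)` the dual of `lim_n Sel(E/ℚ(ζ_{p^n}))` (§5 p. 397), `L_p(E) ∈ Λ`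
(Cor. 18, p. 398). Since `Λ = ⊕_{i=0}^{p−2} Λ(Γ)e_i` (`#Δ = p − 1` prime to `p`; p. 390 "we split `M`
up into the eigenspaces `M = ⊕_{i=0}^{p−2} M_i` where `Δ` acts on `M_i` by the `i`-th power of the
Teichmüller character") the printed divisibility says `e_iL_p(E) ∈ char(e_iX)` for EACH `i`; this is
the component `i = m = (p−1)/2`: `e_mL_p(E) = L_p(E, ω^m, T)`, the `ω^m`-branch of `μ_E`
(Mazur–Tate–Teitelbaum 1986 §I.13: on `[·]⁺` for `m` even, on `[·]⁻` for `m` odd), i.e. `u·ϖ·B_m`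
with `ϖ·Ω_E = Ω⁺_f` (resp. `ϖ·|Ω⁻(E)| = Ω⁻_f`), `B_m = padicLFunctionBranch f α m` (resp.
`padicLFunctionMinusBranch f α m`), `α = unitRoot V p`, `u ∈ ℤ_p^×`. The module `e_mX` in the tree's
subgroup model over `Γ_ℚ`: `κ` the cyclotomic `ℤ_p`-extension of `ℚ`, `F = ℚ(ζ_p)`, `K = ℚ(√p*)`
its quadratic subfield (`θ² = p*`), `H = ker κ ⊓ Gal(ℚ̄/K) ⊓ Gal(ℚ̄/F)` (fixed field
`ℚ_∞·K·F = ℚ(μ_{p^∞})`), `lim_n Sel(E/ℚ(ζ_{p^n})) = Sel_{p^∞}(E/ℚ(μ_{p^∞})) = V.selmerGroupOver p H`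
(§5; the identification of the product sibling), `Δ` = the image of `Gal(ℚ̄/ℚ_∞) = ker κ` acting
by `conjH1`, `ω^{(p−1)/2}(g) = +1` iff `g ∈ Gal(ℚ̄/K)` (the unique quadratic character of
`Δ ≅ (ℤ/p)^×` cuts out `K`), so `e_m Sel = S` := the Selmer classes `t` with `g_* t = t`
(`g ∈ ker κ ∩ Gal(ℚ̄/K)`), `g_* t = −t` (`g ∈ ker κ ∖ Gal(ℚ̄/K)`) — hypothesis `hS`;
`X ≅ Hom(S, ℚ/ℤ)` a `Λ`-dual datum field by field as in the tree's `SelmerDualData` (Greenberg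
LNM 1716 §1 p. 60), `T = γ − 1` for `γ ∈ Gal(ℚ̄/K) ⊓ Gal(ℚ̄/F)` with `κ γ` the generator and
`χ_p(γ)·ζ = 1 + p`, `ζ` torsion (hence `ζ = 1`: the generator of `Γ = Gal(ℚ(μ_{p^∞})/F) ↔ 1 + pℤ_p`).
Conclusion: `X` is `Λ`-torsion (§5 p. 397 via Kato Thm. 17.4 (1), direct summand) and
`u·ϖ·B_m = ι g`, `g ∈ char_Λ X`, `u ∈ ℤ_p^×`, `ι = iwasawaToPowerSeries p`. Transcribed for good
ordinary `p` only (printed for semi-stable `p`). Component sibling of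
`charIdeal_dvd_padicLFunction_cyclotomicPrime` (all `p − 1` components multiplied); named fact,
nothing asserted.
**RETIRED as a separate named fact (cell `b2b-bsdres`, referee ruling R118.3, 2026-08-20;
deprecate-and-add):** this good-ordinary component reading is a KERNEL CONSEQUENCE of the general-`p`
semistable half-eigenspace reading `Wuthrich2014.thm16_halfEigenCharIdeal_dvd_cyclotomicPrime`
(`ReducibleDivisibilityCyclotomicPrimeHalf.lean`, p235418) — derivation
`Wuthrich2014.charIdeal_dvd_padicLFunctionBranch_component_of_half`
(`ReducibleDivisibilityCyclotomicPrimeComponentOfHalf.lean`, p236658). New consumers take the general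
fact; existing consumers migrate to the `…_of_half` form when next touched; this `def` is kept verbatim
only until no module references it, then removed.
[cite: Wuthrich2014, Thm. 16 (p. 397), §5 (p. 397), §3 (p. 390), Cor. 18 (p. 398)]
[cite: MazurTateTeitelbaum1986Invent, §I.13] [cite: GreenbergLNM1716, §1 (p. 60)] -/
def charIdeal_dvd_padicLFunctionBranch_component : Prop :=
  ∀ (p : ℕ) [Fact p.Prime] (V : WeierstrassCurve ℚ) [V.IsElliptic] [V.IsGloballyMinimal]
    (K : Type) [Field K] [NumberField K] [(galRange (K := ℚ) K).Normal]
    (F : Type) [Field F] [NumberField F] [IsCyclotomicExtension {p} ℚ F]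
    [(galRange (K := ℚ) F).Normal]
    {κ : ZpExtension ℚ p} {γ : Field.absoluteGaloisGroup ℚ} {N : ℕ} [NeZero N]
    {f : CuspForm (Gamma0 N) 2}
    (S : AddSubgroup (V.subgroupH1 p (κ.kerSubgroup ⊓ galRange (K := ℚ) K ⊓ galRange (K := ℚ) F)))
    (hSγ : ∀ t ∈ S, V.conjH1 p _ γ t ∈ S)
    (X : Type) [AddCommGroup X] [Module (IwasawaAlgebra p) X]
    (toDual : X →+ (S →+ AddCircle (1 : ℚ))),
    p ≠ 2 → Module.finrank ℚ K = 2 →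
    (∃ θ : K, θ ^ 2 = algebraMap ℚ K ((-1) ^ (p / 2) * p)) →
    IsOrdinaryAt V p → ¬ V.HasIrreducibleModPGaloisRep p →
    κ.IsCyclotomic → κ.IsTopGenerator γ → IsCyclotomicVariable p γ →
    γ ∈ galRange (K := ℚ) K → γ ∈ galRange (K := ℚ) F →
    IsNewformOf V f →
    (∀ t, t ∈ S ↔
      t ∈ V.selmerGroupOver p (κ.kerSubgroup ⊓ galRange (K := ℚ) K ⊓ galRange (K := ℚ) F) ∧
        ∀ g ∈ κ.kerSubgroup,
          V.conjH1 p _ g t = if g ∈ galRange (K := ℚ) K then t else -t) →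
    Function.Bijective toDual →
    (∀ (x : X) (s : S), toDual ((PowerSeries.X : IwasawaAlgebra p) • x) s =
      toDual x ⟨V.conjH1 p _ γ s, hSγ s s.2⟩ - toDual x s) →
    (∀ (c : ℤ_[p]) (x : X) (s : S) (k : ℕ), (p ^ k) • s = 0 →
      toDual (PowerSeries.C c • x) s = (PadicInt.toZModPow k c).val • toDual x s) →
    ∀ (ϖ : ℚ),
      (if Even (p / 2) then (ϖ : ℝ) * V.realPeriodRat = plusPeriod f
        else (ϖ : ℝ) * V.imaginaryPeriodRat = minusPeriod f) →
      Module.IsTorsion (IwasawaAlgebra p) X ∧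
      ∃ g ∈ Literature.NumberTheory.EllipticCurves.Module.charIdeal (IwasawaAlgebra p) X,
        ∃ u : ℤ_[p]ˣ,
          iwasawaToPowerSeries p g =
            PowerSeries.C (((u : ℤ_[p]) : ℚ_[p]) * (ϖ : ℚ_[p])) *
              (if Even (p / 2) then padicLFunctionBranch f ((unitRoot V p : ℤ_[p]) : ℚ_[p]) (p / 2)
                else padicLFunctionMinusBranch f ((unitRoot V p : ℤ_[p]) : ℚ_[p]) (p / 2))

end Literature.NumberTheory.EllipticCurves.Wuthrich2014

end
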